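import Summits.CriticalPhenomena.PercolationContinuityZ3.Theorems.PercNearOneGluingNoHeavyQuantTreeBuiltAD3Rows
import HarnessLib

/-!
# QUANT lane R8, T-DEC, ROUTE 2: `TreeBuiltAD3` BY STRUCTURAL INDUCTION from two EXPLICIT decomposition cells — the gate of a component
# (`AD3GateCell`) and the product of two components (`AD3ProdCell`) — hence `AD3GateCell ∧ AD3ProdCell ⟹ TreeBuiltAD3` (kernel)

builds on p205010 (kernel theorem, internal audit signed; external expert review pending)

Support file (`--supports stmt-CriticalPhenomena-4575`), QUANT lane, TYPER seat prim-quant-stmt (gen 31), rung R8 of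
`run/shared/lean/prim/quant/LADDER.md`; continues `…QuantTreeBuiltCells` (`AD3Decomp`, `TreeBuiltAD3`) and `…QuantTreeBuiltAD3Rows`
(`TreeBuiltAD3 ⟹ FarTreeRow`).  One plain definition (`IsAD3Component`, the component predicate of `AD3Decomp`), two `@[conjecture]` cells,
theorems with standard axioms, no sorries.

THE INDUCTION.  Carry the invariant "AD3⁺-decomposable at every gate `q` and every floor `x′ ≤ x`" along census-2 g53's `TreeBuilt`:
`δ₀`, `δ₁` are heavy degenerate pairs; floor-lowering is free (the invariant quantifies over lower floors); at a GATE `q₀` the law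
`gate μ q₀ = Σ_k v_k·gate(ω_k) q₀` is the mixture of the gated components, and the invariant at gate `q·q₀` supplies components admissible at
gate `q·q₀` — so one needs an AD3⁺ decomposition at gate `q` of the `q₀`-GATE OF ONE COMPONENT (`AD3GateCell`: for pairs and for triples through
`0` this is elementary bookkeeping — a gated pair is a zero pair or a triple through `0`, admissible by `gate_gate` —, the content is the
4-atom law `{0, s₁, s₂, s₃}` = gate of a triple with `s₁ > 0`); at a CONVOLUTION `μ₁ ∗ μ₂ = Σ_{j,k} v_j v′_k·(ω_j ∗ ω′_k)` (bilinearity), so one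
needs an AD3⁺ decomposition of the PRODUCT OF TWO COMPONENTS (`AD3ProdCell`, ≤ 9 atoms).  Mixtures of AD3⁺ decompositions are AD3⁺
decompositions (`ad3Decomp_mixture`).  Both cells are explicit finite-parameter DECOMPOSITION statements (∃ weights), unlike the INEQUALITY
cells PP/PT/TT of Route 1; note `AD3ProdCell ⟹` PP/PT/TT (an AD3⁺-decomposed product is admissible, `gate_decAt_of_AD3Decomp`).
EXACT CENSUS (typer g31, `explore/ad3_gatecell.py`, `ad3_closure.py`; exact LPs): `AD3GateCell` 9 560 instances / 0 (heavy 4 021, light pair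
836, triple 4 703; gates `q, q₀` down to `1/3·1/5`); `AD3ProdCell` 2 350 / 0 (by kinds H⊗H 371, H⊗L2 147, H⊗L3 1 022, L2⊗L2 11, L2⊗L3 168,
L3⊗L3 631; every product also admissible); products of two HEAVY pairs are heavy-decomposable in only 85 % of cases (4 540 / 5 315), so light
components are genuinely needed even there.

* `LawDec.IsAD3Component y q T M ω` — the component predicate (heavy pair / admissible light pair / admissible non-HD triple of mean `T` on `{0..M}`).
* `LawDec.ad3Decomp_of_component`, **`LawDec.ad3Decomp_mixture`** — bookkeeping.
* `LawDec.AD3GateCell`, `LawDec.AD3ProdCell` (`@[conjecture]`).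
* `LawDec.isAD3Component_laws` — a component is a probability law of mean `T` (tool for the cells' provers).
* **`LawDec.treeBuiltAD3_of_cells : AD3GateCell → AD3ProdCell → TreeBuiltAD3`** (the induction `ad3Decomp_of_treeBuilt`, floors `x′ ≤ x` carried
  along so that floor-lowering is free);  **`farTreeRow_of_AD3Cells : AD3GateCell → AD3ProdCell → Quant.FarTreeRow`** (with
  `farTreeRow_of_treeBuiltAD3` of `…QuantTreeBuiltAD3Rows`).
HONEST STATUS: `AD3GateCell`, `AD3ProdCell`, `TreeBuiltAD3`, `TreeBuiltDEC`, `FarTreeRow` OPEN; nothing here is a published result; RATE class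
log\* / honest sentence unchanged.

[this work]; `TreeBuilt`: prim-quant-census-2 g53; mixtures: prim-quant-stmt g22 (this lane).  The gluing rows served
[cite: KozmaNitzan2024, Conjecture 3 (p. 15)]; product measure [cite: Grimmett1999, §1.3 p. 10].
-/

noncomputable section

namespace Summit.CriticalPhenomena.PercolationContinuityZ3.Theorems

namespace Quant

open Finset

/-- two-point law notation `TP[lo, hi, g, h] = g·[h = hi] + (1 − g)·[h = lo]` (as in the lane's other files). -/
local notation3 "TP[" lo ", " hi ", " g ", " h "]" =>
  (g : ℝ) * (if (h : ℕ) = (hi : ℕ) then (1 : ℝ) else 0) + (1 - (g : ℝ)) * (if (h : ℕ) = (lo : ℕ) then (1 : ℝ) else 0)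

/-- three-atom law notation `TR[s₁, s₂, s₃, p₁, p₂, p₃, h] = p₁·[h = s₁] + p₂·[h = s₂] + p₃·[h = s₃]`. -/
local notation3 "TR[" s₁ ", " s₂ ", " s₃ ", " p₁ ", " p₂ ", " p₃ ", " h "]" =>
  (p₁ : ℝ) * (if (h : ℕ) = (s₁ : ℕ) then (1 : ℝ) else 0) + (p₂ : ℝ) * (if (h : ℕ) = (s₂ : ℕ) then (1 : ℝ) else 0)
    + (p₃ : ℝ) * (if (h : ℕ) = (s₃ : ℕ) then (1 : ℝ) else 0)

namespace LawDec

/-! ### Components and mixtures -/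

/-- **AD3⁺ COMPONENT** at floor `y`, gate `q`, mean `T`, top `M`: (H) a heavy pair `{lo, hi; γ}` (`lo ≤ hi ≤ M`, `y ≤ qγ`), (L2) a light pair
(`lo < hi ≤ M`, `qγ < y`) with `gate_q` DEC at every layer `j′ < M`, or (L3) a three-atom law with positive masses, not heavy-decomposable, with
`gate_q` DEC at every layer — each of mean `T`.  Verbatim the disjunction inside `AD3Decomp`. [this work] -/
def IsAD3Component (y q T : ℝ) (M : ℕ) (ω : ℕ → ℝ) : Prop :=
  (∃ (lo hi : ℕ) (γ : ℝ), lo ≤ hi ∧ hi ≤ M ∧ 0 ≤ γ ∧ γ ≤ 1 ∧ y ≤ q * γ ∧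
      (lo : ℝ) + ((hi : ℝ) - lo) * γ = T ∧ ω = fun h => TP[lo, hi, γ, h]) ∨
  (∃ (lo hi : ℕ) (γ : ℝ), lo < hi ∧ hi ≤ M ∧ 0 ≤ γ ∧ γ ≤ 1 ∧ q * γ < y ∧
      (lo : ℝ) + ((hi : ℝ) - lo) * γ = T ∧ (∀ j', j' < M → DECAt y j' M (gate (fun h => TP[lo, hi, γ, h]) q)) ∧
      ω = fun h => TP[lo, hi, γ, h]) ∨
  (∃ (s₁ s₂ s₃ : ℕ) (p₁ p₂ p₃ : ℝ), s₁ < s₂ ∧ s₂ < s₃ ∧ s₃ ≤ M ∧ 0 < p₁ ∧ 0 < p₂ ∧ 0 < p₃ ∧ p₁ + p₂ + p₃ = 1 ∧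
      p₁ * (s₁ : ℝ) + p₂ * (s₂ : ℝ) + p₃ * (s₃ : ℝ) = T ∧
      ((s₂ : ℝ) ≤ T ∧ q * (T - s₂) < y * ((s₃ : ℝ) - s₂) ∨ T < (s₂ : ℝ) ∧ q * (T - s₁) < y * ((s₃ : ℝ) - s₁)) ∧
      (∀ j', j' < M → DECAt y j' M (gate (fun h => TR[s₁, s₂, s₃, p₁, p₂, p₃, h]) q)) ∧
      ω = fun h => TR[s₁, s₂, s₃, p₁, p₂, p₃, h])

/-- `AD3Decomp` unfolded with `IsAD3Component`. [this work] -/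
theorem ad3Decomp_iff (y q T : ℝ) (M : ℕ) (μ : ℕ → ℝ) :
    AD3Decomp y q T M μ ↔ ∃ (κ : Type) (_ : Fintype κ) (v : κ → ℝ) (ω : κ → ℕ → ℝ),
      (∀ k, 0 ≤ v k) ∧ (∑ k, v k = 1) ∧ (∀ h, μ h = ∑ k, v k * ω k h) ∧ (∀ k, 0 < v k → IsAD3Component y q T M (ω k)) :=
  Iff.rfl

/-- a single component is an AD3⁺ decomposition of itself. [this work] -/
theorem ad3Decomp_of_component {y q T : ℝ} {M : ℕ} {ω : ℕ → ℝ} (h : IsAD3Component y q T M ω) : AD3Decomp y q T M ω :=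
  (ad3Decomp_iff y q T M ω).2 ⟨Unit, inferInstance, fun _ => 1, fun _ => ω, fun _ => zero_le_one, by simp, fun h => by simp,
    fun _ _ => h⟩

/-- a point mass `δ_s` (`s ≤ M`) of a law with `y ≤ q` is an AD3⁺ component: the degenerate heavy pair `{s, s; 1}`. [this work] -/
theorem isAD3Component_point (y q : ℝ) (M s : ℕ) (hs : s ≤ M) (hyq : y ≤ q) :
    IsAD3Component y q (s : ℝ) M (fun h => if h = s then (1 : ℝ) else 0) := by
  refine Or.inl ⟨s, s, 1, le_rfl, hs, zero_le_one, le_rfl, by rw [mul_one]; exact hyq, by ring, ?_⟩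
  funext h; ring

/-- **MIXTURES**: if `μ = Σ_i w_i·ν_i` (`w ≥ 0`, `Σ w = 1`) and every charged `ν_i` is AD3⁺-decomposable at `(y, q, T, M)`, so is `μ`. [this work] -/
theorem ad3Decomp_mixture {ι : Type} [Fintype ι] (y q T : ℝ) (M : ℕ) (μ : ℕ → ℝ) (w : ι → ℝ) (ν : ι → ℕ → ℝ)
    (hw0 : ∀ i, 0 ≤ w i) (hw1 : ∑ i, w i = 1) (hμ : ∀ h, μ h = ∑ i, w i * ν i h)
    (hdec : ∀ i, 0 < w i → AD3Decomp y q T M (ν i)) : AD3Decomp y q T M μ := by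
  classical
  have hdec' : ∀ i : {i : ι // 0 < w i}, ∃ (κ : Type) (_ : Fintype κ) (v : κ → ℝ) (ω : κ → ℕ → ℝ),
      (∀ k, 0 ≤ v k) ∧ (∑ k, v k = 1) ∧ (∀ h, ν i.1 h = ∑ k, v k * ω k h) ∧ (∀ k, 0 < v k → IsAD3Component y q T M (ω k)) :=
    fun i => (ad3Decomp_iff y q T M (ν i.1)).1 (hdec i.1 i.2)
  choose κf hfin v ω hv0 hv1 hν hcomp using hdec'
  letI : ∀ i, Fintype (κf i) := hfin
  refine (ad3Decomp_iff y q T M μ).2 ⟨(Σ i : {i : ι // 0 < w i}, κf i), inferInstance, fun p => w p.1.1 * v p.1 p.2,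
    fun p => ω p.1 p.2, fun p => mul_nonneg (hw0 _) (hv0 _ _), ?_, fun h => ?_, fun p hp => ?_⟩
  · rw [Fintype.sum_sigma]
    have e : ∀ i : {i : ι // 0 < w i}, ∑ r : κf i, w i.1 * v i r = w i.1 := fun i => by
      rw [← Finset.mul_sum, hv1 i, mul_one]
    simp only [e]
    have e2 := Finset.sum_subtype (p := fun i => 0 < w i) (F := inferInstance) (Finset.univ.filter (fun i => 0 < w i))
      (by intro i; simp) (fun i => w i)
    rw [← e2, Finset.sum_filter, ← hw1]
    refine Finset.sum_congr rfl fun i _ => ?_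
    by_cases hp : 0 < w i
    · rw [if_pos hp]
    · rw [if_neg hp]; exact le_antisymm (hw0 i) (not_lt.1 hp)
  · rw [hμ h, Fintype.sum_sigma]
    have e : ∀ i : {i : ι // 0 < w i}, ∑ r : κf i, w i.1 * v i r * ω i r h = w i.1 * ν i.1 h := by
      intro i
      rw [hν i h, Finset.mul_sum]
      refine Finset.sum_congr rfl fun r _ => ?_
      ring
    simp only [e]
    have e2 := Finset.sum_subtype (p := fun i => 0 < w i) (F := inferInstance) (Finset.univ.filter (fun i => 0 < w i))
      (by intro i; simp) (fun i => w i * ν i h)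
    rw [← e2, Finset.sum_filter]
    refine Finset.sum_congr rfl fun i _ => ?_
    by_cases hp : 0 < w i
    · rw [if_pos hp]
    · rw [if_neg hp, ← le_antisymm (hw0 i) (not_lt.1 hp), zero_mul]
  · have hvp : 0 < v p.1 p.2 := by
      by_contra hle; rw [not_lt] at hle
      have : w p.1.1 * v p.1 p.2 ≤ 0 := mul_nonpos_of_nonneg_of_nonpos (hw0 _) hle
      linarith
    exact hcomp p.1 p.2 hvp

/-! ### The two decomposition cells -/

/-- **CELL `AD3GateCell` (THE GATE OF A COMPONENT).**  Floor `0 < y`, gates `0 < q, q₀ ≤ 1` with `y < q·q₀`, top-affordability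
`y·M ≤ q·q₀·T`; `ω` an AD3⁺ component at `(y, q·q₀, T, M)`.  Then the gated law `gate ω q₀` (`= (1−q₀)δ₀ + q₀ω`, mean `q₀T`) admits an AD3⁺
decomposition at `(y, q, q₀T, M)`.  For a pair `ω` this is elementary (a gated pair is a zero pair, or a triple through `0` admissible by
`gate_gate`, split into two heavy pairs if heavy-decomposable); the content is the 4-atom law `{0, s₁, s₂, s₃}`, `s₁ > 0`.  EXACT CENSUS
9 560 / 0 (module docstring).
builds on p205010 (kernel theorem, internal audit signed; external expert review pending). [this work] [status: open] -/
@[conjecture] def AD3GateCell : Prop :=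
  ∀ (y q q₀ T : ℝ) (M : ℕ) (ω : ℕ → ℝ),
    0 < y → 0 < q → q ≤ 1 → 0 < q₀ → q₀ ≤ 1 → y < q * q₀ → y * (M : ℝ) ≤ q * q₀ * T →
    IsAD3Component y (q * q₀) T M ω → AD3Decomp y q (q₀ * T) M (gate ω q₀)

/-- **CELL `AD3ProdCell` (THE PRODUCT OF TWO COMPONENTS).**  Floor `0 < y < q`, gate `q ≤ 1`; `ω₁`, `ω₂` AD3⁺ components at `(y, q, T₁, M₁)`,
`(y, q, T₂, M₂)`, top-affordable (`y·Mᵢ ≤ q·Tᵢ`).  Then the convolution `ω₁ ∗ ω₂` (≤ 9 atoms, mean `T₁ + T₂`) admits an AD3⁺ decomposition at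
`(y, q, T₁ + T₂, M₁ + M₂)`.  Implies the inequality cells PP / PT / TT of Route 1 (`gate_decAt_of_AD3Decomp`).  EXACT CENSUS 2 350 / 0 over
the six kind pairs (module docstring).
builds on p205010 (kernel theorem, internal audit signed; external expert review pending). [this work] [status: open] -/
@[conjecture] def AD3ProdCell : Prop :=
  ∀ (y q T₁ T₂ : ℝ) (M₁ M₂ : ℕ) (ω₁ ω₂ : ℕ → ℝ),
    0 < y → y < q → q ≤ 1 → y * (M₁ : ℝ) ≤ q * T₁ → y * (M₂ : ℝ) ≤ q * T₂ →
    IsAD3Component y q T₁ M₁ ω₁ → IsAD3Component y q T₂ M₂ ω₂ →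
    AD3Decomp y q (T₁ + T₂) (M₁ + M₂) (lconv M₁ M₂ ω₁ ω₂)

/-! ### The structural induction -/

/-- component law facts: an AD3⁺ component at `(y, q, T, M)` is a probability law on `{0..M}` of mean `T`. [this work] -/
theorem isAD3Component_laws {y q T : ℝ} {M : ℕ} {ω : ℕ → ℝ} (h : IsAD3Component y q T M ω) :
    (∀ k, 0 ≤ ω k) ∧ (∀ k, M < k → ω k = 0) ∧ (∑ k ∈ Finset.range (M + 1), ω k = 1) ∧
      (∑ k ∈ Finset.range (M + 1), (k : ℝ) * ω k = T) := by
  rcases h with ⟨lo, hi, γ, hlohi, hhi, hγ0, hγ1, -, hmean, hω⟩ | ⟨lo, hi, γ, hlohi, hhi, hγ0, hγ1, -, hmean, -, hω⟩ |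
    ⟨s₁, s₂, s₃, p₁, p₂, p₃, h12, h23, h3, hp₁, hp₂, hp₃, hp, hT, -, -, hω⟩
  · obtain ⟨a, b, c, d⟩ := tp_laws M lo hi γ hγ0 hγ1 hlohi hhi
    rw [hω]; exact ⟨a, b, c, hmean ▸ d⟩
  · obtain ⟨a, b, c, d⟩ := tp_laws M lo hi γ hγ0 hγ1 hlohi.le hhi
    rw [hω]; exact ⟨a, b, c, hmean ▸ d⟩
  · rw [hω]; exact triple_laws' p₁ p₂ p₃ T M s₁ s₂ s₃ (by omega) (by omega) h3 hp₁.le hp₂.le hp₃.le hp hT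

/-- **THE INDUCTION: `AD3GateCell ∧ AD3ProdCell ⟹` every tree-built law is AD3⁺-decomposable at every gate and every floor `x′ ≤ x`.**
[this work] -/
theorem ad3Decomp_of_treeBuilt (hG : AD3GateCell) (hP : AD3ProdCell) {x : ℝ} {M : ℕ} {μ : ℕ → ℝ} (h : TreeBuilt x M μ) :
    ∀ x' : ℝ, 0 < x' → x' ≤ x → ∀ q : ℝ, 0 < q → q ≤ 1 →
      AD3Decomp (q * x') q (∑ k ∈ Finset.range (M + 1), (k : ℝ) * μ k) M μ := by
  induction h with
  | nil x₀ hx0 hx1 =>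
    intro x' hx'0 hx'x q hq0 hq1
    have e : ∑ k ∈ Finset.range (0 + 1), (k : ℝ) * (if k = 0 then (1 : ℝ) else 0) = ((0 : ℕ) : ℝ) := by simp
    rw [e]
    exact ad3Decomp_of_component (isAD3Component_point (q * x') q 0 0 le_rfl (by nlinarith))
  | relay x₀ hx0 hx1 =>
    intro x' hx'0 hx'x q hq0 hq1
    have e : ∑ k ∈ Finset.range (1 + 1), (k : ℝ) * (if k = 1 then (1 : ℝ) else 0) = ((1 : ℕ) : ℝ) := by
      simp
    rw [e]
    exact ad3Decomp_of_component (isAD3Component_point (q * x') q 1 1 le_rfl (by nlinarith))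
  | @conv x₀ M₁ M₂ μ₁ μ₂ h₁ h₂ ih₁ ih₂ =>
    intro x' hx'0 hx'x q hq0 hq1
    obtain ⟨hx0, hx1, n1, z1, s1, t1⟩ := treeBuilt_lawFacts h₁
    obtain ⟨-, -, n2, z2, s2, t2⟩ := treeBuilt_lawFacts h₂
    set T₁ : ℝ := ∑ k ∈ Finset.range (M₁ + 1), (k : ℝ) * μ₁ k with hT₁
    set T₂ : ℝ := ∑ k ∈ Finset.range (M₂ + 1), (k : ℝ) * μ₂ k with hT₂
    rw [sum_mul_lconv M₁ M₂ μ₁ μ₂ s1 s2]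
    have hy0 : 0 < q * x' := mul_pos hq0 hx'0
    have hyq : q * x' < q := by nlinarith
    have hta₁ : q * x' * (M₁ : ℝ) ≤ q * T₁ := by
      have : x' * (M₁ : ℝ) ≤ x₀ * (M₁ : ℝ) := mul_le_mul_of_nonneg_right hx'x (Nat.cast_nonneg _)
      rw [mul_assoc]; exact mul_le_mul_of_nonneg_left (this.trans t1) hq0.le
    have hta₂ : q * x' * (M₂ : ℝ) ≤ q * T₂ := by
      have : x' * (M₂ : ℝ) ≤ x₀ * (M₂ : ℝ) := mul_le_mul_of_nonneg_right hx'x (Nat.cast_nonneg _)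
      rw [mul_assoc]; exact mul_le_mul_of_nonneg_left (this.trans t2) hq0.le
    obtain ⟨κ₁, _, v₁, ω₁, hv₁0, hv₁1, hμ₁, hc₁⟩ := (ad3Decomp_iff _ _ _ _ _).1 (ih₁ x' hx'0 hx'x q hq0 hq1)
    obtain ⟨κ₂, _, v₂, ω₂, hv₂0, hv₂1, hμ₂, hc₂⟩ := (ad3Decomp_iff _ _ _ _ _).1 (ih₂ x' hx'0 hx'x q hq0 hq1)
    -- decompose the second factor, then the first
    have e₂ : μ₂ = fun h => ∑ k, v₂ k * ω₂ k h := funext hμ₂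
    have e₁ : μ₁ = fun h => ∑ k, v₁ k * ω₁ k h := funext hμ₁
    refine ad3Decomp_mixture _ q _ _ _ v₂ (fun k => lconv M₁ M₂ μ₁ (ω₂ k)) hv₂0 hv₂1 (fun h => by rw [e₂]; exact lconv_sum_right M₁ M₂ μ₁ v₂ ω₂ h)
      fun k hk => ?_
    refine ad3Decomp_mixture _ q _ _ _ v₁ (fun j => lconv M₁ M₂ (ω₁ j) (ω₂ k)) hv₁0 hv₁1 (fun h => ?_) fun j hj => ?_
    · rw [e₁, lconv_comm, lconv_sum_right M₂ M₁ (ω₂ k) v₁ ω₁ h]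
      refine Finset.sum_congr rfl fun j _ => ?_
      rw [lconv_comm]
    · exact hP (q * x') q T₁ T₂ M₁ M₂ (ω₁ j) (ω₂ k) hy0 hyq hq1 hta₁ hta₂ (hc₁ j hj) (hc₂ k hk)
  | @gate x₀ M₀ μ₀ q₀ hq₀0 hq₀1 h ih =>
    intro x' hx'0 hx'x q hq0 hq1
    obtain ⟨hx0, hx1, n1, z1, s1, t1⟩ := treeBuilt_lawFacts h
    set T : ℝ := ∑ k ∈ Finset.range (M₀ + 1), (k : ℝ) * μ₀ k with hT
    rw [sum_mul_gate]
    -- the invariant of `μ₀` at floor `x'' = x'/q₀ ≤ x₀` and gate `q·q₀`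
    have hx''0 : 0 < x' / q₀ := div_pos hx'0 hq₀0
    have hx''x : x' / q₀ ≤ x₀ := by rw [div_le_iff₀ hq₀0]; linarith [mul_comm q₀ x₀]
    have hD := ih (x' / q₀) hx''0 hx''x (q * q₀) (mul_pos hq0 hq₀0) (by nlinarith)
    have ey : q * q₀ * (x' / q₀) = q * x' := by field_simp
    rw [ey] at hD
    obtain ⟨κ, _, v, ω, hv0, hv1, hμ, hc⟩ := (ad3Decomp_iff _ _ _ _ _).1 hD
    have hy0 : 0 < q * x' := mul_pos hq0 hx'0
    have hyqq : q * x' < q * q₀ := by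
      have : x' < q₀ := lt_of_le_of_lt hx'x (by nlinarith)
      nlinarith
    have hta : q * x' * (M₀ : ℝ) ≤ q * q₀ * T := by
      have h1 : x' * (M₀ : ℝ) ≤ q₀ * (x₀ * (M₀ : ℝ)) := by
        have : x' * (M₀ : ℝ) ≤ (q₀ * x₀) * (M₀ : ℝ) := mul_le_mul_of_nonneg_right hx'x (Nat.cast_nonneg _)
        linarith [mul_assoc q₀ x₀ (M₀ : ℝ)]
      have h2 : q₀ * (x₀ * (M₀ : ℝ)) ≤ q₀ * T := mul_le_mul_of_nonneg_left t1 hq₀0.le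
      nlinarith [mul_le_mul_of_nonneg_left (h1.trans h2) hq0.le]
    have eμ : μ₀ = fun h => ∑ k, v k * ω k h := funext hμ
    refine ad3Decomp_mixture _ q _ _ _ v (fun k => gate (ω k) q₀) hv0 hv1 (fun h => by rw [eμ]; exact gate_sum_mixture v ω q₀ hv1 h)
      fun k hk => hG (q * x') q q₀ T M₀ (ω k) hy0 hq0 hq1 hq₀0 hq₀1 hyqq hta (hc k hk)
  | @mono x₀ x'' M₀ μ₀ h hx''0 hxx ih =>
    intro x' hx'0 hx'x q hq0 hq1
    exact ih x' hx'0 (hx'x.trans hxx) q hq0 hq1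

/-- **`AD3GateCell ∧ AD3ProdCell ⟹ TreeBuiltAD3`.** [this work] -/
theorem treeBuiltAD3_of_cells (hG : AD3GateCell) (hP : AD3ProdCell) : TreeBuiltAD3 := by
  intro x M μ h q hq0 hq1
  obtain ⟨hx0, hx1, -⟩ := treeBuilt_lawFacts h
  exact ad3Decomp_of_treeBuilt hG hP h x hx0 le_rfl q hq0 hq1

end LawDec

/-- **`AD3GateCell ∧ AD3ProdCell ⟹ Quant.FarTreeRow`** — ROUTE 2 end to end: the R8 tree row from the two explicit decomposition cells
(through `TreeBuiltAD3`, `farTreeRow_of_treeBuiltAD3`).  CONDITIONAL on the two cells (OPEN). [this work] -/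
theorem farTreeRow_of_AD3Cells (hG : LawDec.AD3GateCell) (hP : LawDec.AD3ProdCell) : FarTreeRow :=
  farTreeRow_of_treeBuiltAD3 (LawDec.treeBuiltAD3_of_cells hG hP)

end Quant

end Summit.CriticalPhenomena.PercolationContinuityZ3.Theorems
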